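import Summits.CriticalPhenomena.CardyFormulaZ2.Theorems.CardyComplexConeParafermionToSLESixFamiliesDiamondDefs
import Literature.Probability.LatticeModels.ScalingLimitRiemannSums
import HarnessLib

/-!
# Line `potential-darboux-picard-diamond`, conjunct (b′) of S3: discrete Morera toolkit for face potentials

Helper file of the conditional stub of S3 (b′) `ClosedClass` (`closedClass_of_edgeCoherence_edgePrecompact`) of crux
`ParafermionToSLESixFamilies` (stmt-CriticalPhenomena-11389), line `potential-darboux-picard-diamond`.

**The analytic toolkit of the class structure of potential limits (no percolation input).** Faces of `u_k ℤ²` are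
indexed by their lower-left corner (centre `ctr`). At a lattice vertex `v` the three faces `NE = v`, `NW = v − e₀`,
`SE = v − e₁` of a face function `H` carry the HOLOMORPHIC VERTEX DEFECT `T_H(v) = (i − 1) H(NE) − i H(NW) + H(SE)`
(`vtxDefect`). Summed over the `N × M` vertices of a lattice rectangle the defects telescope to the discrete contour sum
of `H` around it (`sum_vtxDefect`), and a double sum with an EVEN number of columns is controlled by the sums of
consecutive column PAIRS (`norm_sum_sum_le_of_pair`) — pairs are what the staggered character `χ = i` of the corner
observable delivers. The boundary rows/columns are Riemann sums: if `H_k − z_k → G` at the face centres uniformly on a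
compact `K` and `G` is continuous on `K`, the side sums converge to the side integrals of `G` (`tendsto_faceSum`, from the
tree's `Literature.Probability.LatticeModels.tendsto_mul_sum_of_tendstoUniformlyOn` repackaged with eventual hypotheses,
`tendsto_riemann_eventually`). Finally `differentiableOn_of_rect_integral` is Morera's theorem in the form used by the
line: a function continuous on an open set all of whose axis-parallel rectangle integrals (sorted corners) vanish is
holomorphic (Mathlib's `Complex.isConservativeOn_and_continuousOn_iff_isDifferentiableOn` + the four orientations).
-/

noncomputable section

namespace Summit.CriticalPhenomena.CardyFormulaZ2.Cruxes.ParafermionToSLESixFamilies.PotentialDarbouxPicardDiamond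

open scoped Topology
open Filter Set Metric Complex
open Literature.Probability Literature.Probability.LatticeModels

/-! ## Riemann sums with eventual hypotheses -/

/-- **Riemann sums of a continuous function at lattice sample points** (eventual form of the tree's
`tendsto_mul_sum_of_tendstoUniformlyOn`): `K` compact, `g` continuous on `K`, `0 < δ_k → 0`, `N_k δ_k → ℓ ≥ 0`,
`γ s = p + s v` a unit-speed line with `γ [a₀ − m₀, a₀ + ℓ + m₀] ⊆ K`; if EVENTUALLY the sample points `P k t`, `t < N_k`,
lie in `K` within `C δ_k` of `γ (a₀ + t δ_k)`, then `δ_k Σ_{t<N_k} g (P k t) → ∫_{a₀}^{a₀+ℓ} g (γ s) ds`. -/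
theorem tendsto_riemann_eventually {K : Set ℂ} (hK : IsCompact K) {g : ℂ → ℂ} (hg : ContinuousOn g K)
    {δ : ℕ → ℝ} (hδ0 : ∀ k, 0 < δ k) (hδ : Tendsto δ atTop (𝓝 0))
    {N : ℕ → ℕ} {ℓ : ℝ} (hℓ : 0 ≤ ℓ) (hN : Tendsto (fun k => (N k : ℝ) * δ k) atTop (𝓝 ℓ))
    {p v : ℂ} (hv : ‖v‖ = 1) {a₀ m₀ : ℝ} (hm₀ : 0 < m₀)
    (hγK : (fun s : ℝ => p + (s : ℂ) * v) '' Icc (a₀ - m₀) (a₀ + ℓ + m₀) ⊆ K)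
    {C : ℝ} (hC : 0 ≤ C) {P : ℕ → ℕ → ℂ}
    (hP : ∀ᶠ k in atTop, ∀ t, t < N k →
      P k t ∈ K ∧ dist (P k t) (p + ((a₀ + t * δ k : ℝ) : ℂ) * v) ≤ C * δ k) :
    Tendsto (fun k => (δ k : ℂ) * ∑ t ∈ Finset.range (N k), g (P k t)) atTop
      (𝓝 (∫ s in a₀..(a₀ + ℓ), g (p + (s : ℂ) * v))) := by
  classical
  set good : ℕ → Prop := fun k => ∀ t, t < N k →
    P k t ∈ K ∧ dist (P k t) (p + ((a₀ + t * δ k : ℝ) : ℂ) * v) ≤ C * δ k with hgood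
  set N' : ℕ → ℕ := fun k => if good k then N k else 0 with hN'
  have hNN' : ∀ᶠ k in atTop, N' k = N k := by
    filter_upwards [hP] with k hk
    have hk' : good k := hk
    simp only [hN', if_pos hk']
  have hN'lim : Tendsto (fun k => (N' k : ℝ) * δ k) atTop (𝓝 ℓ) :=
    hN.congr' (by filter_upwards [hNN'] with k hk; rw [hk])
  have hboth : ∀ k t, t < N' k →
      P k t ∈ K ∧ dist (P k t) (p + ((a₀ + t * δ k : ℝ) : ℂ) * v) ≤ C * δ k := by
    intro k t ht
    by_cases hk : good k
    · exact hk t (by simpa only [hN', if_pos hk] using ht)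
    · simp only [hN', if_neg hk] at ht; exact absurd ht (Nat.not_lt_zero t)
  have huc : TendstoUniformlyOn (fun _ : ℕ => g) g atTop K :=
    Metric.tendstoUniformlyOn_iff.2 fun ε hε => Eventually.of_forall fun k x _ => by simpa using hε
  have h := tendsto_mul_sum_of_tendstoUniformlyOn hK hg huc hδ0 hδ hℓ hN'lim hv hm₀ hγK hC
    (fun k t ht => (hboth k t ht).1) (fun k t ht => (hboth k t ht).2)
  refine h.congr' ?_
  filter_upwards [hNN'] with k hk
  rw [hk]

/-! ## The vertex defect, the faces of a lattice rectangle, telescoping and pairing -/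

/-- The HOLOMORPHIC VERTEX DEFECT of a face function `H` at the lattice vertex `v`:
`(i − 1) H(NE) − i H(NW) + H(SE)` with `NE = v`, `NW = v − e₀`, `SE = v − e₁` (faces indexed by lower-left corner).
It equals `i (H(NE) − H(NW)) − (H(NE) − H(SE))`, the integrand of the discrete contour sum `∮ H dz`. -/
def vtxDefect (H : Site 2 → ℂ) (v : Site 2) : ℂ :=
  (I - 1) * H v - I * H (v - Pi.single 0 1) + H (v - Pi.single 1 1)

/-- The face `g + (s, t)` of the lattice rectangle based at the face `g`. -/
def fc (g : Site 2) (s t : ℤ) : Site 2 := fun i => if i = 0 then g 0 + s else g 1 + t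

/-- First coordinate of a face of the rectangle. -/
@[simp] theorem fc_zero (g : Site 2) (s t : ℤ) : fc g s t 0 = g 0 + s := by simp [fc]

/-- Second coordinate of a face of the rectangle. -/
@[simp] theorem fc_one (g : Site 2) (s t : ℤ) : fc g s t 1 = g 1 + t := by simp [fc]

/-- Moving one face to the left. -/
theorem fc_sub_e0 (g : Site 2) (s t : ℤ) : fc g s t - Pi.single 0 1 = fc g (s - 1) t := by
  ext i; fin_cases i
  · simp [fc]; ring
  · simp [fc]

/-- Moving one face down. -/
theorem fc_sub_e1 (g : Site 2) (s t : ℤ) : fc g s t - Pi.single 1 1 = fc g s (t - 1) := by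
  ext i; fin_cases i
  · simp [fc]
  · simp [fc]; ring

/-- Moving one face to the right. -/
theorem fc_add_e0 (g : Site 2) (s t : ℤ) : fc g s t + Pi.single 0 1 = fc g (s + 1) t := by
  ext i; fin_cases i
  · simp [fc]; ring
  · simp [fc]

/-- Real part of the centre of a face. -/
theorem ctr_re (δ : ℝ) (f : Site 2) : (ctr δ f).re = δ * f 0 + δ / 2 := by simp [ctr]

/-- Imaginary part of the centre of a face. -/
theorem ctr_im (δ : ℝ) (f : Site 2) : (ctr δ f).im = δ * f 1 + δ / 2 := by simp [ctr]

/-- The defect at the vertex `g + (s+1, t+1)` in difference form. -/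
theorem vtxDefect_fc (H : Site 2 → ℂ) (g : Site 2) (s t : ℕ) :
    vtxDefect H (fc g ((s + 1 : ℕ) : ℤ) ((t + 1 : ℕ) : ℤ)) =
      I * (H (fc g ((s + 1 : ℕ) : ℤ) ((t + 1 : ℕ) : ℤ)) - H (fc g s ((t + 1 : ℕ) : ℤ))) -
        (H (fc g ((s + 1 : ℕ) : ℤ) ((t + 1 : ℕ) : ℤ)) - H (fc g ((s + 1 : ℕ) : ℤ) t)) := by
  rw [vtxDefect, fc_sub_e0, fc_sub_e1]
  push_cast
  ring_nf

/-- **Telescoping.** The vertex defects over the `N × M` vertices `g + (s+1, t+1)` of the lattice rectangle sum to the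
discrete contour sum `i Σ_t (H(N, t+1) − H(0, t+1)) − Σ_s (H(s+1, M) − H(s+1, 0))`. -/
theorem sum_vtxDefect (H : Site 2 → ℂ) (g : Site 2) (N M : ℕ) :
    ∑ s ∈ Finset.range N, ∑ t ∈ Finset.range M, vtxDefect H (fc g ((s + 1 : ℕ) : ℤ) ((t + 1 : ℕ) : ℤ)) =
      I * ∑ t ∈ Finset.range M, (H (fc g N ((t + 1 : ℕ) : ℤ)) - H (fc g ((0 : ℕ) : ℤ) ((t + 1 : ℕ) : ℤ))) -
        ∑ s ∈ Finset.range N, (H (fc g ((s + 1 : ℕ) : ℤ) M) - H (fc g ((s + 1 : ℕ) : ℤ) ((0 : ℕ) : ℤ))) := by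
  set F : ℕ → ℕ → ℂ := fun s t => H (fc g s t) with hF
  have hA : ∀ t : ℕ, ∑ s ∈ Finset.range N, (F (s + 1) (t + 1) - F s (t + 1)) = F N (t + 1) - F 0 (t + 1) :=
    fun t => Finset.sum_range_sub (fun s : ℕ => F s (t + 1)) N
  have hB : ∀ s : ℕ, ∑ t ∈ Finset.range M, (F (s + 1) (t + 1) - F (s + 1) t) = F (s + 1) M - F (s + 1) 0 :=
    fun s => Finset.sum_range_sub (fun t : ℕ => F (s + 1) t) M
  calc ∑ s ∈ Finset.range N, ∑ t ∈ Finset.range M, vtxDefect H (fc g ((s + 1 : ℕ) : ℤ) ((t + 1 : ℕ) : ℤ))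
      = ∑ s ∈ Finset.range N, ∑ t ∈ Finset.range M,
          (I * (F (s + 1) (t + 1) - F s (t + 1)) - (F (s + 1) (t + 1) - F (s + 1) t)) :=
        Finset.sum_congr rfl fun s _ => Finset.sum_congr rfl fun t _ => vtxDefect_fc H g s t
    _ = ∑ s ∈ Finset.range N, ((∑ t ∈ Finset.range M, I * (F (s + 1) (t + 1) - F s (t + 1))) -
          ∑ t ∈ Finset.range M, (F (s + 1) (t + 1) - F (s + 1) t)) :=
        Finset.sum_congr rfl fun s _ => Finset.sum_sub_distrib _ _
    _ = (∑ s ∈ Finset.range N, ∑ t ∈ Finset.range M, I * (F (s + 1) (t + 1) - F s (t + 1))) -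
          ∑ s ∈ Finset.range N, ∑ t ∈ Finset.range M, (F (s + 1) (t + 1) - F (s + 1) t) :=
        Finset.sum_sub_distrib _ _
    _ = (∑ t ∈ Finset.range M, ∑ s ∈ Finset.range N, I * (F (s + 1) (t + 1) - F s (t + 1))) -
          ∑ s ∈ Finset.range N, ∑ t ∈ Finset.range M, (F (s + 1) (t + 1) - F (s + 1) t) := by
        rw [Finset.sum_comm]
    _ = (∑ t ∈ Finset.range M, I * (F N (t + 1) - F 0 (t + 1))) -
          ∑ s ∈ Finset.range N, (F (s + 1) M - F (s + 1) 0) := by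
        congr 1
        · exact Finset.sum_congr rfl fun t _ => by rw [← Finset.mul_sum, hA]
        · exact Finset.sum_congr rfl fun s _ => hB s
    _ = I * ∑ t ∈ Finset.range M, (H (fc g N ((t + 1 : ℕ) : ℤ)) - H (fc g ((0 : ℕ) : ℤ) ((t + 1 : ℕ) : ℤ))) -
        ∑ s ∈ Finset.range N, (H (fc g ((s + 1 : ℕ) : ℤ) M) - H (fc g ((s + 1 : ℕ) : ℤ) ((0 : ℕ) : ℤ))) := by
        rw [Finset.mul_sum]

/-- Splitting a sum over `2n` terms into consecutive pairs. -/
theorem sum_range_two_mul {M : Type*} [AddCommMonoid M] (f : ℕ → M) (n : ℕ) :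
    ∑ s ∈ Finset.range (2 * n), f s = ∑ j ∈ Finset.range n, (f (2 * j) + f (2 * j + 1)) := by
  induction n with
  | zero => simp
  | succ n ih =>
    rw [Nat.mul_succ, Finset.sum_range_succ, Finset.sum_range_succ, ih, Finset.sum_range_succ, add_assoc]

/-- **Pairing.** If the sums of consecutive column pairs are bounded by `η`, the double sum over `2n` columns and `M`
rows is bounded by `n M η`. -/
theorem norm_sum_sum_le_of_pair {X : ℕ → ℕ → ℂ} {n M : ℕ} {η : ℝ}
    (h : ∀ j < n, ∀ t < M, ‖X (2 * j + 1) (t + 1) + X (2 * j + 2) (t + 1)‖ ≤ η) :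
    ‖∑ s ∈ Finset.range (2 * n), ∑ t ∈ Finset.range M, X (s + 1) (t + 1)‖ ≤ n * M * η := by
  rw [sum_range_two_mul]
  have hj : ∀ j ∈ Finset.range n, ‖(∑ t ∈ Finset.range M, X (2 * j + 1) (t + 1)) +
      ∑ t ∈ Finset.range M, X (2 * j + 1 + 1) (t + 1)‖ ≤ M * η := by
    intro j hj
    rw [← Finset.sum_add_distrib]
    refine (norm_sum_le_of_le _ fun t ht => h j (Finset.mem_range.1 hj) t (Finset.mem_range.1 ht)).trans ?_
    simp
  refine (norm_sum_le_of_le _ hj).trans ?_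
  simp only [Finset.sum_const, Finset.card_range, nsmul_eq_mul]
  ring_nf; rfl

/-! ## Side sums of a face potential converge to side integrals -/

/-- **Side sums.** If `H_k − z_k` is `ε`-close to `G` at the face centres in `K` eventually (for every `ε`), `G` is
continuous on the compact `K`, and the sample faces `F k t`, `t < L_k` (`L_k u_k → ℓ`), have centres eventually in `K`
within `C u_k` of `γ (a₀ + t u_k)` for a unit-speed line `γ s = p + s v` with `γ [a₀ − m₀, a₀ + ℓ + m₀] ⊆ K`, then
`u_k Σ_{t < L_k} (H_k (F k t) − z_k) → ∫_{a₀}^{a₀+ℓ} G (γ s) ds`. -/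
theorem tendsto_faceSum {K : Set ℂ} (hK : IsCompact K) {G : ℂ → ℂ} (hG : ContinuousOn G K)
    {u : ℕ → ℝ} (hu : ∀ k, 0 < u k) (hu0 : Tendsto u atTop (𝓝 0)) {H : ℕ → Site 2 → ℂ} {z : ℕ → ℂ}
    (hlim : ∀ ε > (0:ℝ), ∀ᶠ k in atTop, ∀ f : Site 2, ctr (u k) f ∈ K → ‖H k f - z k - G (ctr (u k) f)‖ ≤ ε)
    {L : ℕ → ℕ} {ℓ : ℝ} (hℓ : 0 ≤ ℓ) (hL : Tendsto (fun k => (L k : ℝ) * u k) atTop (𝓝 ℓ))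
    {p v : ℂ} (hv : ‖v‖ = 1) {a₀ m₀ : ℝ} (hm₀ : 0 < m₀)
    (hγK : (fun s : ℝ => p + (s : ℂ) * v) '' Icc (a₀ - m₀) (a₀ + ℓ + m₀) ⊆ K)
    {C : ℝ} (hC : 0 ≤ C) {F : ℕ → ℕ → Site 2}
    (hF : ∀ᶠ k in atTop, ∀ t, t < L k → ctr (u k) (F k t) ∈ K ∧
      dist (ctr (u k) (F k t)) (p + ((a₀ + t * u k : ℝ) : ℂ) * v) ≤ C * u k) :
    Tendsto (fun k => (u k : ℂ) * ∑ t ∈ Finset.range (L k), (H k (F k t) - z k)) atTop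
      (𝓝 (∫ s in a₀..(a₀ + ℓ), G (p + (s : ℂ) * v))) := by
  have h1 := tendsto_riemann_eventually hK hG hu hu0 hℓ hL hv hm₀ hγK hC hF
  have h2 : Tendsto (fun k => (u k : ℂ) * ∑ t ∈ Finset.range (L k),
      (H k (F k t) - z k - G (ctr (u k) (F k t)))) atTop (𝓝 0) := by
    rw [Metric.tendsto_nhds]
    intro ε hε
    have hL1 : ∀ᶠ k in atTop, (L k : ℝ) * u k ≤ ℓ + 1 :=
      (hL.eventually (Iic_mem_nhds (by linarith))).mono fun k hk => hk
    filter_upwards [hlim (ε / (ℓ + 2)) (by positivity), hF, hL1] with k hk hFk hLk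
    rw [dist_zero_right]
    calc ‖(u k : ℂ) * ∑ t ∈ Finset.range (L k), (H k (F k t) - z k - G (ctr (u k) (F k t)))‖
        ≤ u k * ∑ t ∈ Finset.range (L k), ε / (ℓ + 2) := by
          rw [norm_mul, Complex.norm_real, Real.norm_of_nonneg (hu k).le]
          exact mul_le_mul_of_nonneg_left
            (norm_sum_le_of_le _ fun t ht => hk _ (hFk t (Finset.mem_range.1 ht)).1) (hu k).le
      _ = (L k * u k) * (ε / (ℓ + 2)) := by
          simp only [Finset.sum_const, Finset.card_range, nsmul_eq_mul]; ring
      _ ≤ (ℓ + 1) * (ε / (ℓ + 2)) := by gcongr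
      _ < ε := by
          rw [← sub_pos]
          have : ε - (ℓ + 1) * (ε / (ℓ + 2)) = ε / (ℓ + 2) := by field_simp; ring
          rw [this]; positivity
  have h3 := h1.add h2
  rw [add_zero] at h3
  refine h3.congr' (Eventually.of_forall fun k => ?_)
  simp only
  rw [← mul_add, ← Finset.sum_add_distrib]
  congr 1
  exact Finset.sum_congr rfl fun t _ => by ring

/-- Points of the enlarged interval are within `ρ` of the interval. -/
theorem exists_near_Icc {c d ρ s : ℝ} (hcd : c ≤ d) (hρ : 0 ≤ ρ) (hs : s ∈ Icc (c - ρ) (d + ρ)) :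
    ∃ y ∈ Icc c d, |s - y| ≤ ρ := by
  rcases le_total s c with h | h
  · exact ⟨c, ⟨le_rfl, hcd⟩, by rw [abs_le]; constructor <;> linarith [hs.1]⟩
  rcases le_total d s with h' | h'
  · exact ⟨d, ⟨hcd, le_rfl⟩, by rw [abs_le]; constructor <;> linarith [hs.2]⟩
  · exact ⟨s, ⟨h, h'⟩, by simpa using hρ⟩

/-! ## Morera: vanishing sorted rectangle integrals give holomorphy -/

/-- **Morera's theorem, sorted-rectangle form.** A function continuous on an open set `U`, all of whose boundary
integrals over closed axis-parallel rectangles `[a, b] × [c, d] ⊆ U` (`a ≤ b`, `c ≤ d`) vanish, is holomorphic on `U`. -/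
theorem differentiableOn_of_rect_integral : ∀ {U : Set ℂ}, IsOpen U → ∀ {G : ℂ → ℂ}, ContinuousOn G U → (∀ a b c d : ℝ, a ≤ b → c ≤ d → (Icc a b ×ℂ Icc c d) ⊆ U → (∫ x in a..b, G (x + c * I)) - (∫ x in a..b, G (x + d * I)) + I * (∫ y in c..d, G (b + y * I)) - I * (∫ y in c..d, G (a + y * I)) = 0) → DifferentiableOn ℂ G U := by
  intro U hU G hG h
  rw [← Complex.isConservativeOn_and_continuousOn_iff_isDifferentiableOn hU]
  refine ⟨fun z w hzw => ?_, hG⟩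
  rw [eq_neg_iff_add_eq_zero, Complex.wedgeIntegral_add_wedgeIntegral_eq]
  simp only [smul_eq_mul]
  change uIcc z.re w.re ×ℂ uIcc z.im w.im ⊆ U at hzw
  rcases le_total z.re w.re with h1 | h1 <;> rcases le_total z.im w.im with h2 | h2
  · rw [uIcc_of_le h1, uIcc_of_le h2] at hzw
    exact h _ _ _ _ h1 h2 hzw
  · rw [uIcc_of_le h1, uIcc_of_ge h2] at hzw
    have := h _ _ _ _ h1 h2 hzw
    simp only [intervalIntegral.integral_symm w.im z.im]
    linear_combination (-1 : ℂ) * this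
  · rw [uIcc_of_ge h1, uIcc_of_le h2] at hzw
    have := h _ _ _ _ h1 h2 hzw
    simp only [intervalIntegral.integral_symm w.re z.re]
    linear_combination (-1 : ℂ) * this
  · rw [uIcc_of_ge h1, uIcc_of_ge h2] at hzw
    have := h _ _ _ _ h1 h2 hzw
    simp only [intervalIntegral.integral_symm w.re z.re, intervalIntegral.integral_symm w.im z.im]
    linear_combination this

end Summit.CriticalPhenomena.CardyFormulaZ2.Cruxes.ParafermionToSLESixFamilies.PotentialDarbouxPicardDiamond

end
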